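import Summits.QuantumFields.YangMills.Theorems.LuscherReductionDressedRitzPolyakovLiftStaticsDressedResidual
import HarnessLib

/-!
# Line «polyakovlift» r3 on crux `DressedRitz` (stmt-QuantumFields-20205): symmetry zeros at EVERY Euclidean separation —
# the two-time forms `(f, h) ↦ ⟨K_β^a u_f, K_β^b u_h⟩` are `S₃`-invariant, so cross COUPLINGS (clause (o6)) between symmetry-separated channels vanish too

Fleet-service module of seat ym-infvol-p1 g5 (route `LuscherReduction`, femto rung R2b1; skeleton of record r3 `11209be61e7d2ff5`).  The files
`…PolyakovLiftStaticsSymmetry ∕ …StaticsDoublet ∕ …StaticsDressedSymmetry ∕ …StaticsDressedResidual` proved the symmetry zeros of the TIME-0 clause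
(o2) (`⟨u'_i, u'_l⟩ = 0` for `S₃`-separated pairs and doublets).  The disprover (cdisprove-20205-1 g1, (G1-b)) noted that the same bookkeeping governs the
cross-COUPLING clause (o6) of the lead's stub S-POS («same argument with the invariant form `⟨·, K_β·⟩`»).  This file proves it, for all separations at once:

* §1 `l2_iterIns_comp_configPerm` — for a raw vacuum, the two-time form `B_{a,b}(f,h) = ⟨K^a u_f, K^b u_h⟩` (`u_f = OpPlat.ins φ (flowLiftAt 0 t f)`) is
  `S₃`-invariant for EVERY `a, b, t`; `l2_iter_iter_eq_right` — it depends on `a + b` only (hence is symmetric); `iterIns_lincomb` — linear in `f`;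
* §2 `sum_weight_l2_iterIns_eq_zero` (averaging), ★ `l2_iterIns_eq_zero_of_invariant`, ★ `l2_iterIns_eq_zero_of_sign`, ★ `l2_iterIns_doublet` — the
  symmetry zeros (invariant vs. zero-average, sign type, doublets: Schur `2×2`) for every `a, b`;
* §3 r3 corollaries: `l2_dressed_pair_eq_zero_of_invariant` — `⟨u'_i, K_β u'_l⟩ = 0 = ⟨u'_i, u'_l⟩` for the DRESSED family and such pairs — and
  ★ `dressedLiftFamily_o6_of_symmetrySeparated ∕ _of_doublet`: the (o6) inequality of `DynamicCoreClauses` (text of p523114 VERBATIM) holds with ANY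
  `C ≥ 0` for these pairs (both `d_il` and `⟨u'_i,u'_l⟩` vanish).  So, like (o2), the OPEN content of (o6) is confined to pairs of channels from two
  different one-site levels of the same `S₃`-type.

HONEST FRAMING: exact symmetry bookkeeping at fixed lattice on the CONDITIONAL femto rung R2b1; nothing of the RG estimates ((o2),(o5),(o6) same-type,
(o4)) is proved; nothing here bears on infinite volume, the continuum limit or the Clay gap.  References: M. Lüscher, NPB 219 (1983) 233, §2
[cite: Luscher1983, §2]; M. Lüscher, U. Wolff, NPB 339 (1990) 222 [cite: LuscherWolff1990].
-/

set_option autoImplicit false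

noncomputable section

open MeasureTheory Filter Topology
open Literature.MathematicalPhysics.QuantumFieldTheory
open Literature.MathematicalPhysics.QuantumLattice
open scoped BigOperators

namespace Summit.QuantumFields.YangMills.Theorems.FemtoTransferGap.PolyakovLift

open Summit.QuantumFields.YangMills.Theorems.FemtoTransferGap

/-! ## §1 The two-time forms are invariant, depend on `a + b` only, and are bilinear -/

section Forms

variable {L : ℕ} [NeZero L]

/-- **`⟨K^a u_{f∘P}, K^b u_{h∘P}⟩ = ⟨K^a u_f, K^b u_h⟩`** for a raw vacuum `φ`, every `a b : ℕ`, flow time `t` and axis permutation `P`.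
[cite: Luscher1983, §2] -/
theorem l2_iterIns_comp_configPerm (β : ℝ) {φ : GaugeConfig 3 L SU2 → ℝ} (hφ : IsPhys φ)
    (heig : transferApply β φ = levelValue su2Rep L β 0 • φ) (π : Equiv.Perm (Fin 3)) (t : ℝ) (f h : GaugeConfig 3 1 SU2 → ℝ) (a b : ℕ) :
    l2 ((transferApply β)^[a] (OpPlat.ins φ (flowLiftAt 0 t fun V => f (configPerm π V))))
        ((transferApply β)^[b] (OpPlat.ins φ (flowLiftAt 0 t fun V => h (configPerm π V)))) =
      l2 ((transferApply β)^[a] (OpPlat.ins φ (flowLiftAt 0 t f))) ((transferApply β)^[b] (OpPlat.ins φ (flowLiftAt 0 t h))) := by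
  rw [ins_flowLiftAt_comp_configPerm_eq β hφ heig π t f, ins_flowLiftAt_comp_configPerm_eq β hφ heig π t h,
    iterate_transferApply_comp_configPerm, iterate_transferApply_comp_configPerm, l2_comp_configPerm]

/-- `⟨K^a u, K^b v⟩ = ⟨u, K^{a+b} v⟩` for physical `u, v`: the two-time form depends on the total separation only. [folklore] -/
theorem l2_iter_iter_eq_right (β : ℝ) {u v : GaugeConfig 3 L SU2 → ℝ} (hu : IsPhys u) (hv : IsPhys v) (a b : ℕ) :
    l2 ((transferApply β)^[a] u) ((transferApply β)^[b] v) = l2 u ((transferApply β)^[a + b] v) := by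
  rw [l2_iterate_left_right β hu hv b a, l2_comm]
  have e := l2_iterate_left_right β hv hu (a + b) 0
  simp only [Function.iterate_zero, id_eq, zero_add] at e
  rw [e, l2_comm]

/-- `K^a` of the channel vector is linear in the one-site function. [folklore] -/
theorem iterIns_lincomb (β : ℝ) {φ : GaugeConfig 3 L SU2 → ℝ} (hφ : IsPhys φ) (t : ℝ) (c d : ℝ)
    {f h : GaugeConfig 3 1 SU2 → ℝ} (hf : IsPhys f) (hh : IsPhys h) (a : ℕ) :
    (transferApply β)^[a] (OpPlat.ins φ (flowLiftAt 0 t fun V => c * f V + d * h V)) =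
      c • (transferApply β)^[a] (OpPlat.ins φ (flowLiftAt 0 t f)) + d • (transferApply β)^[a] (OpPlat.ins φ (flowLiftAt 0 t h)) := by
  rw [ins_flowLiftAt_lincomb hφ 0 t c d hf hh,
    iterate_transferApply_lincomb β (OpPlat.isPhys_ins hφ (isPhys_flowLiftAt 0 t hf)) (OpPlat.isPhys_ins hφ (isPhys_flowLiftAt 0 t hh))]

end Forms

/-! ## §2 Symmetry zeros of the two-time forms -/

section Zeros

variable {L : ℕ} [NeZero L]

/-- Averaging lemma, two-time: `Σ_π w(π) ⟨X, K^b u_{h∘P_π}⟩ = 0` for physical `X`, weights with `Σ_π w(π) h(P_π V) = 0`. [folklore] -/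
theorem sum_weight_l2_iterIns_eq_zero (β : ℝ) {φ X : GaugeConfig 3 L SU2 → ℝ} (hφ : IsPhys φ) (hX : IsPhys X) (t : ℝ)
    {h : GaugeConfig 3 1 SU2 → ℝ} (hh : IsPhys h) (w : Equiv.Perm (Fin 3) → ℝ) (b : ℕ)
    (hsum : ∀ V, ∑ π : Equiv.Perm (Fin 3), w π * h (configPerm π V) = 0) :
    ∑ π : Equiv.Perm (Fin 3), w π * l2 X ((transferApply β)^[b] (OpPlat.ins φ (flowLiftAt 0 t fun V => h (configPerm π V)))) = 0 := by
  set Y : GaugeConfig 3 L SU2 → ℝ := (transferApply β)^[b] X with hY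
  have hYp : IsPhys Y := isPhys_iterate_transferApply β hX b
  have hterm : ∀ π : Equiv.Perm (Fin 3), l2 X ((transferApply β)^[b] (OpPlat.ins φ (flowLiftAt 0 t fun V => h (configPerm π V)))) =
      l2 Y (flowLiftAt 0 t (fun V => h (configPerm π V)) * φ) -
        l2 φ (flowLiftAt 0 t (fun V => h (configPerm π V)) * φ) * l2 Y φ := fun π => by
    have hF : IsPhys (flowLiftAt (L := L) 0 t fun V => h (configPerm π V)) := isPhys_flowLiftAt 0 t (hh.comp_configPerm π)
    have hu : IsPhys (OpPlat.ins φ (flowLiftAt (L := L) 0 t fun V => h (configPerm π V))) := OpPlat.isPhys_ins hφ hF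
    have h0 := l2_iterate_left_right β hX hu b 0
    simp only [Function.iterate_zero, id_eq, zero_add] at h0
    rw [h0, ← hY, OpPlat.ins_eq, l2_comm, sub_eq_add_neg, ← neg_smul,
      l2_add_left (OpPlat.isPhys_mul hF hφ) (hφ.smul _) hYp, l2_smul_left, l2_comm (flowLiftAt 0 t _ * φ), l2_comm φ Y]
    ring
  simp_rw [hterm, mul_sub, Finset.sum_sub_distrib]
  have h1 := sum_weight_l2_flowLiftAt_eq_zero hφ hYp t hh w hsum
  have h2 := sum_weight_l2_flowLiftAt_eq_zero hφ hφ t hh w hsum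
  have h3 : ∑ π : Equiv.Perm (Fin 3), w π * (l2 φ (flowLiftAt 0 t (fun V => h (configPerm π V)) * φ) * l2 Y φ) =
      (∑ π : Equiv.Perm (Fin 3), w π * l2 φ (flowLiftAt 0 t (fun V => h (configPerm π V)) * φ)) * l2 Y φ := by
    rw [Finset.sum_mul]; exact Finset.sum_congr rfl fun π _ => by ring
  rw [h1, h3, h2, zero_mul, sub_zero]

/-- ★ **Two-time symmetry zero (invariant vs. non-invariant)**: `⟨K^a u_f, K^b u_h⟩ = 0` for every `a, b` when `f` is `S₃`-invariant and `h` has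
vanishing `S₃`-average (raw vacuum `φ`). [cite: Luscher1983, §2] -/
theorem l2_iterIns_eq_zero_of_invariant (β : ℝ) {φ : GaugeConfig 3 L SU2 → ℝ} (hφ : IsPhys φ)
    (heig : transferApply β φ = levelValue su2Rep L β 0 • φ) (t : ℝ) {f h : GaugeConfig 3 1 SU2 → ℝ} (hf : IsPhys f) (hh : IsPhys h)
    (hfinv : ∀ π : Equiv.Perm (Fin 3), (fun V => f (configPerm π V)) = f)
    (hhavg : ∀ V, ∑ π : Equiv.Perm (Fin 3), h (configPerm π V) = 0) (a b : ℕ) :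
    l2 ((transferApply β)^[a] (OpPlat.ins φ (flowLiftAt 0 t f))) ((transferApply β)^[b] (OpPlat.ins φ (flowLiftAt 0 t h))) = 0 := by
  have hcard : (Fintype.card (Equiv.Perm (Fin 3)) : ℝ) ≠ 0 := Nat.cast_ne_zero.mpr Fintype.card_ne_zero
  have hsum1 : ∀ V, ∑ π : Equiv.Perm (Fin 3), (1 : ℝ) * h (configPerm π V) = 0 := fun V => by simpa only [one_mul] using hhavg V
  have hX : IsPhys ((transferApply (L := L) β)^[a] (OpPlat.ins φ (flowLiftAt 0 t f))) :=
    isPhys_iterate_transferApply β (OpPlat.isPhys_ins hφ (isPhys_flowLiftAt 0 t hf)) a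
  have hπ : ∀ π : Equiv.Perm (Fin 3),
      l2 ((transferApply β)^[a] (OpPlat.ins φ (flowLiftAt 0 t f))) ((transferApply β)^[b] (OpPlat.ins φ (flowLiftAt 0 t h))) =
      (1 : ℝ) * l2 ((transferApply β)^[a] (OpPlat.ins φ (flowLiftAt 0 t f)))
        ((transferApply β)^[b] (OpPlat.ins φ (flowLiftAt 0 t fun V => h (configPerm π V)))) := fun π => by
    rw [one_mul, ← l2_iterIns_comp_configPerm β hφ heig π t f h a b, hfinv π]
  have hs := sum_weight_l2_iterIns_eq_zero β hφ hX t hh (fun _ => 1) b hsum1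
  rw [← Finset.sum_congr rfl fun π _ => hπ π, Finset.sum_const, Finset.card_univ, nsmul_eq_mul] at hs
  exact (mul_eq_zero.mp hs).resolve_left hcard

/-- ★ **Two-time symmetry zero (sign type)**. [cite: Luscher1983, §2] -/
theorem l2_iterIns_eq_zero_of_sign (β : ℝ) {φ : GaugeConfig 3 L SU2 → ℝ} (hφ : IsPhys φ)
    (heig : transferApply β φ = levelValue su2Rep L β 0 • φ) (t : ℝ) {f h : GaugeConfig 3 1 SU2 → ℝ} (hf : IsPhys f) (hh : IsPhys h)
    (hfsgn : ∀ π : Equiv.Perm (Fin 3), (fun V => f (configPerm π V)) = ((Equiv.Perm.sign π : ℤ) : ℝ) • f)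
    (hhavg : ∀ V, ∑ π : Equiv.Perm (Fin 3), ((Equiv.Perm.sign π : ℤ) : ℝ) * h (configPerm π V) = 0) (a b : ℕ) :
    l2 ((transferApply β)^[a] (OpPlat.ins φ (flowLiftAt 0 t f))) ((transferApply β)^[b] (OpPlat.ins φ (flowLiftAt 0 t h))) = 0 := by
  have hcard : (Fintype.card (Equiv.Perm (Fin 3)) : ℝ) ≠ 0 := Nat.cast_ne_zero.mpr Fintype.card_ne_zero
  have hX : IsPhys ((transferApply (L := L) β)^[a] (OpPlat.ins φ (flowLiftAt 0 t f))) :=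
    isPhys_iterate_transferApply β (OpPlat.isPhys_ins hφ (isPhys_flowLiftAt 0 t hf)) a
  have hlin : ∀ π : Equiv.Perm (Fin 3), (transferApply β)^[a] (OpPlat.ins φ (flowLiftAt (L := L) 0 t fun V => f (configPerm π V))) =
      ((Equiv.Perm.sign π : ℤ) : ℝ) • (transferApply β)^[a] (OpPlat.ins φ (flowLiftAt 0 t f)) := by
    intro π
    have hfun : (fun V => f (configPerm π V)) = fun V => ((Equiv.Perm.sign π : ℤ) : ℝ) * f V + 0 * f V := by
      rw [hfsgn π]; funext V; simp only [Pi.smul_apply, smul_eq_mul, zero_mul, add_zero]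
    rw [hfun, iterIns_lincomb β hφ t _ 0 hf hf a, zero_smul, add_zero]
  have hπ : ∀ π : Equiv.Perm (Fin 3),
      l2 ((transferApply β)^[a] (OpPlat.ins φ (flowLiftAt 0 t f))) ((transferApply β)^[b] (OpPlat.ins φ (flowLiftAt 0 t h))) =
      ((Equiv.Perm.sign π : ℤ) : ℝ) * l2 ((transferApply β)^[a] (OpPlat.ins φ (flowLiftAt 0 t f)))
        ((transferApply β)^[b] (OpPlat.ins φ (flowLiftAt 0 t fun V => h (configPerm π V)))) := fun π => by
    have hinv := l2_iterIns_comp_configPerm β hφ heig π t f h a b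
    rw [hlin π, l2_smul_left] at hinv
    exact hinv.symm
  have hs := sum_weight_l2_iterIns_eq_zero β hφ hX t hh _ b hhavg
  rw [← Finset.sum_congr rfl fun π _ => hπ π, Finset.sum_const, Finset.card_univ, nsmul_eq_mul] at hs
  exact (mul_eq_zero.mp hs).resolve_left hcard

/-- ★ **Two-time doublet lemma**: for a rotating doublet `(f₁, f₂)` (some axis permutation, `cs² + sn² = 1`, `sn ≠ 0`) and every `a, b`:
`⟨K^a u_{f₁}, K^b u_{f₂}⟩ = 0` and `⟨K^a u_{f₁}, K^b u_{f₁}⟩ = ⟨K^a u_{f₂}, K^b u_{f₂}⟩` (the form depends on `a + b` only, is symmetric, bilinear and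
invariant; Schur `2×2`). [cite: Luscher1983, §2] -/
theorem l2_iterIns_doublet (β : ℝ) {φ : GaugeConfig 3 L SU2 → ℝ} (hφ : IsPhys φ)
    (heig : transferApply β φ = levelValue su2Rep L β 0 • φ) (t : ℝ) {f₁ f₂ : GaugeConfig 3 1 SU2 → ℝ} (hf₁ : IsPhys f₁) (hf₂ : IsPhys f₂)
    (c : Equiv.Perm (Fin 3)) {cs sn : ℝ} (hrot : cs ^ 2 + sn ^ 2 = 1) (hsn : sn ≠ 0)
    (h₁ : (fun V => f₁ (configPerm c V)) = fun V => cs * f₁ V + sn * f₂ V)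
    (h₂ : (fun V => f₂ (configPerm c V)) = fun V => -sn * f₁ V + cs * f₂ V) (a b : ℕ) :
    l2 ((transferApply β)^[a] (OpPlat.ins φ (flowLiftAt 0 t f₁))) ((transferApply β)^[b] (OpPlat.ins φ (flowLiftAt 0 t f₂))) = 0 ∧
      l2 ((transferApply β)^[a] (OpPlat.ins φ (flowLiftAt 0 t f₁))) ((transferApply β)^[b] (OpPlat.ins φ (flowLiftAt 0 t f₁))) =
        l2 ((transferApply β)^[a] (OpPlat.ins φ (flowLiftAt 0 t f₂))) ((transferApply β)^[b] (OpPlat.ins φ (flowLiftAt 0 t f₂))) := by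
  -- abbreviate the symmetric form `Φ x y := ⟨x-channel, K^{a+b} y-channel⟩`
  have hu : ∀ {e : GaugeConfig 3 1 SU2 → ℝ}, IsPhys e → IsPhys (OpPlat.ins φ (flowLiftAt (L := L) 0 t e)) :=
    fun he => OpPlat.isPhys_ins hφ (isPhys_flowLiftAt 0 t he)
  have hrf : IsPhys fun V => cs * f₁ V + sn * f₂ V := by
    have : (fun V => cs * f₁ V + sn * f₂ V) = cs • f₁ + sn • f₂ := by funext V; simp [smul_eq_mul]
    rw [this]; exact (hf₁.smul cs).add (hf₂.smul sn)
  have hrg : IsPhys fun V => -sn * f₁ V + cs * f₂ V := by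
    have : (fun V => -sn * f₁ V + cs * f₂ V) = (-sn) • f₁ + cs • f₂ := by funext V; simp [smul_eq_mul]
    rw [this]; exact (hf₁.smul (-sn)).add (hf₂.smul cs)
  -- bilinear expansion helpers (left and right slots)
  have linL : ∀ {x y e : GaugeConfig 3 1 SU2 → ℝ} (hx : IsPhys x) (hy : IsPhys y) (he : IsPhys e) (p q : ℝ),
      l2 ((transferApply β)^[a] (OpPlat.ins φ (flowLiftAt 0 t fun V => p * x V + q * y V)))
          ((transferApply β)^[b] (OpPlat.ins φ (flowLiftAt 0 t e))) =
        p * l2 ((transferApply β)^[a] (OpPlat.ins φ (flowLiftAt 0 t x))) ((transferApply β)^[b] (OpPlat.ins φ (flowLiftAt 0 t e))) +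
        q * l2 ((transferApply β)^[a] (OpPlat.ins φ (flowLiftAt 0 t y))) ((transferApply β)^[b] (OpPlat.ins φ (flowLiftAt 0 t e))) := by
    intro x y e hx hy he p q
    rw [iterIns_lincomb β hφ t p q hx hy a]
    exact l2_lincomb_left' (isPhys_iterate_transferApply β (hu hx) a) (isPhys_iterate_transferApply β (hu hy) a)
      (isPhys_iterate_transferApply β (hu he) b) p q
  have linR : ∀ {x y e : GaugeConfig 3 1 SU2 → ℝ} (hx : IsPhys x) (hy : IsPhys y) (he : IsPhys e) (p q : ℝ),
      l2 ((transferApply β)^[a] (OpPlat.ins φ (flowLiftAt 0 t e)))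
          ((transferApply β)^[b] (OpPlat.ins φ (flowLiftAt 0 t fun V => p * x V + q * y V))) =
        p * l2 ((transferApply β)^[a] (OpPlat.ins φ (flowLiftAt 0 t e))) ((transferApply β)^[b] (OpPlat.ins φ (flowLiftAt 0 t x))) +
        q * l2 ((transferApply β)^[a] (OpPlat.ins φ (flowLiftAt 0 t e))) ((transferApply β)^[b] (OpPlat.ins φ (flowLiftAt 0 t y))) := by
    intro x y e hx hy he p q
    rw [iterIns_lincomb β hφ t p q hx hy b, l2_comm,
      l2_lincomb_left' (isPhys_iterate_transferApply β (hu hx) b) (isPhys_iterate_transferApply β (hu hy) b)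
        (isPhys_iterate_transferApply β (hu he) a) p q, l2_comm ((transferApply β)^[b] _), l2_comm ((transferApply β)^[b] _)]
  -- symmetry of the form: `⟨K^a u_y, K^b u_x⟩ = ⟨K^a u_x, K^b u_y⟩`
  have hsym : l2 ((transferApply β)^[a] (OpPlat.ins φ (flowLiftAt 0 t f₂))) ((transferApply β)^[b] (OpPlat.ins φ (flowLiftAt 0 t f₁))) =
      l2 ((transferApply β)^[a] (OpPlat.ins φ (flowLiftAt 0 t f₁))) ((transferApply β)^[b] (OpPlat.ins φ (flowLiftAt 0 t f₂))) := by
    rw [l2_iter_iter_eq_right β (hu hf₂) (hu hf₁), l2_iter_iter_eq_right β (hu hf₁) (hu hf₂)]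
    have e := l2_iterate_left_right β (hu hf₂) (hu hf₁) (a + b) 0
    simp only [Function.iterate_zero, id_eq, zero_add] at e
    rw [e]
    exact l2_comm _ _
  have e1 := (l2_iterIns_comp_configPerm β hφ heig c t f₁ f₁ a b).symm
  rw [h₁, linL hf₁ hf₂ hrf, linR hf₁ hf₂ hf₁, linR hf₁ hf₂ hf₂, hsym] at e1
  have e2 := (l2_iterIns_comp_configPerm β hφ heig c t f₁ f₂ a b).symm
  rw [h₁, h₂, linL hf₁ hf₂ hrg, linR hf₁ hf₂ hf₁, linR hf₁ hf₂ hf₂, hsym] at e2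
  set A : ℝ := l2 ((transferApply β)^[a] (OpPlat.ins φ (flowLiftAt (L := L) 0 t f₁))) ((transferApply β)^[b] (OpPlat.ins φ (flowLiftAt 0 t f₁)))
  set B : ℝ := l2 ((transferApply β)^[a] (OpPlat.ins φ (flowLiftAt (L := L) 0 t f₁))) ((transferApply β)^[b] (OpPlat.ins φ (flowLiftAt 0 t f₂)))
  set D : ℝ := l2 ((transferApply β)^[a] (OpPlat.ins φ (flowLiftAt (L := L) 0 t f₂))) ((transferApply β)^[b] (OpPlat.ins φ (flowLiftAt 0 t f₂)))
  have h3 : sn * (sn * (A - D) - 2 * cs * B) = 0 := by linear_combination e1 + A * hrot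
  have h4 : sn * (A - D) - 2 * cs * B = 0 := (mul_eq_zero.mp h3).resolve_left hsn
  have h5 : sn * (2 * sn * B + cs * (A - D)) = 0 := by linear_combination e2 + B * hrot
  have h6 : 2 * sn * B + cs * (A - D) = 0 := (mul_eq_zero.mp h5).resolve_left hsn
  have hB0 : B = 0 := by
    have h7 : 2 * B * (sn ^ 2 + cs ^ 2) = 0 := by linear_combination sn * h6 - cs * h4
    have h8 : sn ^ 2 + cs ^ 2 = 1 := by linarith
    rw [h8, mul_one] at h7
    linarith
  have hAD : A = D := by
    have h9 : sn * (A - D) = 0 := by linear_combination h4 + 2 * cs * hB0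
    have := (mul_eq_zero.mp h9).resolve_left hsn
    linarith
  exact ⟨hB0, hAD⟩

end Zeros

/-! ## §3 r3 corollaries: one-step couplings `⟨u'_i, K_β u'_l⟩` and the (o6) inequality for symmetry-separated pairs -/

section Coupling

variable {L : ℕ} [NeZero L]

/-- `⟨u'_i, K_β u'_l⟩` of the dressed family is the two-time form at `(m, m+1)`. [folklore] -/
theorem l2_dressed_transferApply_eq_iterIns (β : ℝ) (φ : GaugeConfig 3 L SU2 → ℝ) {k : ℕ}
    (g : Fin k → (GaugeConfig 3 1 SU2 → ℝ)) (i l : Fin k) :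
    l2 (dressedLiftFamily β φ g i) (transferApply β (dressedLiftFamily β φ g l)) =
      l2 ((transferApply β)^[dressSteps L] (OpPlat.ins φ (flowLiftAt 0 (flowTime β L) (g i))))
        ((transferApply β)^[dressSteps L + 1] (OpPlat.ins φ (flowLiftAt 0 (flowTime β L) (g l)))) := by
  rw [Function.iterate_succ_apply']; rfl

/-- **`⟨u'_i, K_β u'_l⟩ = 0` and `⟨u'_i, u'_l⟩ = 0`** for symmetry-separated channels of the dressed family. [cite: Luscher1983, §2] -/
theorem l2_dressed_pair_eq_zero_of_invariant (β : ℝ) {φ : GaugeConfig 3 L SU2 → ℝ} (hφ : IsPhys φ)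
    (heig : transferApply β φ = levelValue su2Rep L β 0 • φ) {k : ℕ} {g : Fin k → (GaugeConfig 3 1 SU2 → ℝ)} (hg : ∀ j, IsPhys (g j))
    (i l : Fin k) (hinv : ∀ π : Equiv.Perm (Fin 3), (fun V => g i (configPerm π V)) = g i)
    (havg : ∀ V, ∑ π : Equiv.Perm (Fin 3), g l (configPerm π V) = 0) :
    l2 (dressedLiftFamily β φ g i) (transferApply β (dressedLiftFamily β φ g l)) = 0 ∧
      l2 (dressedLiftFamily β φ g l) (transferApply β (dressedLiftFamily β φ g i)) = 0 ∧
      l2 (dressedLiftFamily β φ g i) (dressedLiftFamily β φ g l) = 0 := by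
  refine ⟨?_, ?_, ?_⟩
  · rw [l2_dressed_transferApply_eq_iterIns]
    exact l2_iterIns_eq_zero_of_invariant β hφ heig _ (hg i) (hg l) hinv havg _ _
  · rw [l2_dressed_transferApply_eq_iterIns, l2_comm]
    exact l2_iterIns_eq_zero_of_invariant β hφ heig _ (hg i) (hg l) hinv havg _ _
  · show l2 (dressedLiftVec β φ (g i)) (dressedLiftVec β φ (g l)) = 0
    exact l2_dressedLiftVec_eq_zero_of_invariant β hφ heig (hg i) (hg l) hinv havg

/-- ★ **Clause (o6) of `DynamicCoreClauses` (p523114, VERBATIM inequality) holds with ANY `C ≥ 0` for symmetry-separated pairs of the dressed family**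
(`S₃`-invariant channel vs. zero-average channel, either order): the coupling `d_il` and the overlap `⟨u'_i,u'_l⟩` both vanish. [cite: Luscher1983, §2] -/
theorem dressedLiftFamily_o6_of_symmetrySeparated (β : ℝ) {φ : GaugeConfig 3 L SU2 → ℝ} (hvac : IsRawVacuum β φ)
    {B : ℝ} {k : ℕ} {ω : GaugeConfig 3 1 SU2 → ℝ} {g : Fin k → (GaugeConfig 3 1 SU2 → ℝ)} (hbasis : LiftBasis B k ω g)
    {C : ℝ} (hC : 0 ≤ C) (i l : Fin k)
    (hsep : ((∀ π : Equiv.Perm (Fin 3), (fun V => g i (configPerm π V)) = g i) ∧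
        (∀ V, ∑ π : Equiv.Perm (Fin 3), g l (configPerm π V) = 0)) ∨
      ((∀ π : Equiv.Perm (Fin 3), (fun V => g l (configPerm π V)) = g l) ∧
        (∀ V, ∑ π : Equiv.Perm (Fin 3), g i (configPerm π V) = 0))) :
    |l2 (dressedLiftFamily β φ g i) (transferApply β (dressedLiftFamily β φ g l)) -
        (l2 (dressedLiftFamily β φ g i) (transferApply β (dressedLiftFamily β φ g i)) /
              l2 (dressedLiftFamily β φ g i) (dressedLiftFamily β φ g i) +
            l2 (dressedLiftFamily β φ g l) (transferApply β (dressedLiftFamily β φ g l)) /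
              l2 (dressedLiftFamily β φ g l) (dressedLiftFamily β φ g l)) / 2 *
          l2 (dressedLiftFamily β φ g i) (dressedLiftFamily β φ g l)|
      ≤ C * (luscherLambda β L ^ 2 / L) * levelValue su2Rep L β 0 *
          (Real.sqrt (l2 (dressedLiftFamily β φ g i) (dressedLiftFamily β φ g i)) *
            Real.sqrt (l2 (dressedLiftFamily β φ g l) (dressedLiftFamily β φ g l))) := by
  obtain ⟨hφ, -, heig⟩ := hvac
  have hg : ∀ j, IsPhys (g j) := hbasis.2.2.2.2.1
  have hd : l2 (dressedLiftFamily β φ g i) (transferApply β (dressedLiftFamily β φ g l)) = 0 ∧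
      l2 (dressedLiftFamily β φ g i) (dressedLiftFamily β φ g l) = 0 := by
    rcases hsep with ⟨hinv, havg⟩ | ⟨hinv, havg⟩
    · obtain ⟨h1, -, h3⟩ := l2_dressed_pair_eq_zero_of_invariant β hφ heig hg i l hinv havg
      exact ⟨h1, h3⟩
    · obtain ⟨-, h2, h3⟩ := l2_dressed_pair_eq_zero_of_invariant β hφ heig hg l i hinv havg
      exact ⟨h2, by rw [l2_comm]; exact h3⟩
  rw [hd.1, hd.2, mul_zero, sub_zero, abs_zero]
  have hl0 : 0 ≤ levelValue su2Rep L β 0 := by rw [levelValue_zero]; exact topValue_nonneg su2Rep L β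
  exact mul_nonneg (mul_nonneg (mul_nonneg hC (div_nonneg (sq_nonneg _) (Nat.cast_nonneg _))) hl0)
    (mul_nonneg (Real.sqrt_nonneg _) (Real.sqrt_nonneg _))

/-- ★ **Clause (o6) holds with ANY `C ≥ 0` for a rotating doublet of the dressed family** (both `d_il` and the overlap vanish by the two-time doublet
lemma). [cite: Luscher1983, §2] -/
theorem dressedLiftFamily_o6_of_doublet (β : ℝ) {φ : GaugeConfig 3 L SU2 → ℝ} (hvac : IsRawVacuum β φ)
    {B : ℝ} {k : ℕ} {ω : GaugeConfig 3 1 SU2 → ℝ} {g : Fin k → (GaugeConfig 3 1 SU2 → ℝ)} (hbasis : LiftBasis B k ω g)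
    {C : ℝ} (hC : 0 ≤ C) (i l : Fin k) (c : Equiv.Perm (Fin 3)) {cs sn : ℝ} (hrot : cs ^ 2 + sn ^ 2 = 1) (hsn : sn ≠ 0)
    (h₁ : (fun V => g i (configPerm c V)) = fun V => cs * g i V + sn * g l V)
    (h₂ : (fun V => g l (configPerm c V)) = fun V => -sn * g i V + cs * g l V) :
    |l2 (dressedLiftFamily β φ g i) (transferApply β (dressedLiftFamily β φ g l)) -
        (l2 (dressedLiftFamily β φ g i) (transferApply β (dressedLiftFamily β φ g i)) /
              l2 (dressedLiftFamily β φ g i) (dressedLiftFamily β φ g i) +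
            l2 (dressedLiftFamily β φ g l) (transferApply β (dressedLiftFamily β φ g l)) /
              l2 (dressedLiftFamily β φ g l) (dressedLiftFamily β φ g l)) / 2 *
          l2 (dressedLiftFamily β φ g i) (dressedLiftFamily β φ g l)|
      ≤ C * (luscherLambda β L ^ 2 / L) * levelValue su2Rep L β 0 *
          (Real.sqrt (l2 (dressedLiftFamily β φ g i) (dressedLiftFamily β φ g i)) *
            Real.sqrt (l2 (dressedLiftFamily β φ g l) (dressedLiftFamily β φ g l))) := by
  obtain ⟨hφ, -, heig⟩ := hvac
  have hg : ∀ j, IsPhys (g j) := hbasis.2.2.2.2.1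
  have hd : l2 (dressedLiftFamily β φ g i) (transferApply β (dressedLiftFamily β φ g l)) = 0 := by
    rw [l2_dressed_transferApply_eq_iterIns]
    exact (l2_iterIns_doublet β hφ heig _ (hg i) (hg l) c hrot hsn h₁ h₂ _ _).1
  have hn : l2 (dressedLiftFamily β φ g i) (dressedLiftFamily β φ g l) = 0 := by
    show l2 (dressedLiftVec β φ (g i)) (dressedLiftVec β φ (g l)) = 0
    exact (l2_dressed_doublet_eq_zero_and_var_eq β hφ heig (hg i) (hg l) c hrot hsn h₁ h₂).1
  rw [hd, hn, mul_zero, sub_zero, abs_zero]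
  have hl0 : 0 ≤ levelValue su2Rep L β 0 := by rw [levelValue_zero]; exact topValue_nonneg su2Rep L β
  exact mul_nonneg (mul_nonneg (mul_nonneg hC (div_nonneg (sq_nonneg _) (Nat.cast_nonneg _))) hl0)
    (mul_nonneg (Real.sqrt_nonneg _) (Real.sqrt_nonneg _))

end Coupling

end Summit.QuantumFields.YangMills.Theorems.FemtoTransferGap.PolyakovLift

end
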